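import Summits.ResolutionOfSingularities.ResolutionOfSingularities.Theorems.SplitTowerFrame

/-!
# Split-cone tower — slice P: the fibre of one curve blow-up over a point of the curve

Node «SplitTower» of `decomp-res-lens-2` (g34), see `Theorems/MaxContactCutSplitTower.lean`.

Fix a regular locally Noetherian `Y`, the blowing up `π : Y₁ → Y` of a centre `C`, a point `x` of the curve `cl{ζ}`
(`ζ ⤳ x`, `x ≠ ζ`) carrying a split shape `D` of `𝓘_x` along the curve prime `𝔓 = 𝔓_{ζ,x}` whose frame `c = D.c`
generates `C_x`, and a chart family `F` of `π` centred at `x` (slice `SplitTowerCharts`).  For the controlled transform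
`𝓘₁ = (𝓘𝒪 : (C𝒪)ⁿ)`:

* `closed_fibre_cases` — at a point `x₁` over `x` with `𝓘₁ ⊆ 𝔪ⁿ`: Hironaka's `τ ≥ 2`, or `x₁ = q₂ 𝔴` is a point of
  the `W`-chart with `e₀, e₁ ∈ 𝔴` (an *origin-type* point);
* `origin_fibre` — at an origin-type point the transform carries a split shape of weight `k - n` along `𝔓̃ S`;
* `eq_originPt` — over the generic point `ζ`, the ONLY point with `𝓘₁ ⊆ 𝔪ⁿ` is `ζ₁ = q₂ 𝔴̃₀` (the new curve point);
* `exit_generic` / `exit_closed` — if `k - n < n` the order drops below `n` at `ζ₁`, and `τ ≥ 2` at every order-`n`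
  point over `x`;
* `le_pow_originPt`, `eq_of_originPt_specializes`, `exists_origin_of_originPt_specializes`,
  `shape_of_originPt_specializes`, `tau_of_not_specializes` — if `n ≤ k - n`: `𝓘₁ ⊆ 𝔪ⁿ` at `ζ₁`, the
  specialisations of `ζ₁` over `x` are exactly the origin-type points, each carries a split shape of weight `k - n`
  along the new curve prime `𝔓_{ζ₁,·}`, and `τ ≥ 2` at every other order-`n` point.
[cite: CossartJannsenSaito2020, Ch. 2] [cite: Hironaka1964]
-/

noncomputable section

open CategoryTheory AlgebraicGeometry TopologicalSpace Topology IsLocalRing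
open Literature.AlgebraicGeometry.Resolution
open Summit.ResolutionOfSingularities.ResolutionOfSingularities.Theorems
open Summit.ResolutionOfSingularities.ResolutionOfSingularities.Theorems.WeakOrderReduction
open Summit.ResolutionOfSingularities.ResolutionOfSingularities.Theorems.RelativeDeltaCut
open Summit.ResolutionOfSingularities.ResolutionOfSingularities.Theorems.SplitCut

namespace Summit.ResolutionOfSingularities.ResolutionOfSingularities.Theorems.SplitTower

/-! ## §P0  Specialisations between chart points (canonical point forms) -/

section Canonical

variable {Y' Y : Scheme.{0}} {π : Y' ⟶ Y} {s : Y} {m : ℕ} {c : Fin m → Y.presheaf.stalk s}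
  (F : ChartFamily π s c)

/-- `q_j` is continuous: `p ⤳ 𝔴` in `Spec B_j` gives `q_j p ⤳ q_j 𝔴`. [folklore] -/
theorem ChartFamily.qSpecializes (j : Fin m) {p w : Spec (.of (chartRing c j))} (h : p ⤳ w) :
    F.q j p ⤳ F.q j w :=
  (F.q j).base.hom.map_specializes h

/-- The prime of `q_j p ⤳ q_j 𝔴` in `𝒪_{Y', q_j 𝔴}` is `p χ_𝔴` (`ChartFamily.primeOfSpecializes_eq_map`).
[cite: StacksProject, Tag 01HR] -/
theorem ChartFamily.primeOfSpecializes_q (j : Fin m) {p w : Spec (.of (chartRing c j))} (h : p ⤳ w) :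
    primeOfSpecializes (F.qSpecializes j h) = p.asIdeal.map (F.χ j w) :=
  F.primeOfSpecializes_eq_map j h

end Canonical

section Point

variable {Y : Scheme.{0}} [IsLocallyNoetherian Y] {C J : Y.IdealSheafData} {n k : ℕ} {ζ x : Y} {hζx : ζ ⤳ x}
  (D : SplitShape (stalkIdeal J x) (curvePrime hζx) n k) (hc : Ideal.span (Set.range D.c) = stalkIdeal C x)
  (F : ChartFamily (blowup.π C) x D.c)

include D hc F

/-! ## §P1  Over the special point `x` -/

set_option maxHeartbeats 400000 in -- WRITER NOTE (g16): pre-budgeted (elaboration exceeds 100k = half the tree default; ops-buildfix standing ask)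
/-- **THE FIBRE OVER `x`**: at a point `x₁` over `x` with `𝓘₁ ⊆ 𝔪ⁿ`, either Hironaka's `τ(𝓘₁, x₁) ≥ 2`, or `x₁` is
an origin-type point of the `W`-chart (slice `SplitTowerChartW`, `SplitShape.closed_law`). [cite: Hironaka1964] -/
theorem closed_fibre_cases (hY' : Scheme.IsRegular ↑(blowup C)) (hn : 2 ≤ n) (hnk : n ≤ k)
    (x' : ↑(blowup C)) (hx' : blowup.π C x' = x)
    (hle : stalkIdeal (controlledTransform (blowup.π C) C J n) x' ≤ maximalIdeal _ ^ n) :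
    2 ≤ tauAt hY' (controlledTransform (blowup.π C) C J n) n x' ∨
      ∃ w : Spec (.of (chartRing D.c 2)), F.q 2 w = x' ∧
        chartGen D.c 2 0 ∈ w.asIdeal ∧ chartGen D.c 2 1 ∈ w.asIdeal := by
  haveI := CentreSeq.isLocallyNoetherian_blowup C
  obtain ⟨j, w, rfl⟩ := F.cover x' (specializes_of_eq hx')
  rw [F.stalkIdeal_controlledTransform C J n hc j w] at hle
  rcases D.closed_law hn hnk j w (F.χ j w) (F.isLocalization j w) (F.comap_eq_maximalIdeal j hx')
      ((F.χ j w).comp (chartBase D.c j)) (fun _ => rfl) hle with hτ | ⟨hj, hgen⟩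
  · left
    haveI := hY' (F.q j w)
    obtain ⟨y, hy⟩ := exists_regularSystemOfParameters
      (R := ((↑(blowup C) : Scheme.{0})).presheaf.stalk (F.q j w))
    change 2 ≤ stalkTau (controlledTransform (blowup.π C) C J n) (F.q j w) n
    rw [stalkTau_eq _ (F.q j w) n rfl y hy, F.stalkIdeal_controlledTransform C J n hc j w]
    exact hτ y hy
  · subst hj
    exact Or.inr ⟨w, rfl, hgen 0 (by decide), hgen 1 (by decide)⟩

/-- **THE ORIGIN-TYPE POINTS OVER `x`** carry a split shape of weight `k - n` along the extended origin prime
`𝔓̃ S` (`SplitShape.origin`). [cite: CossartJannsenSaito2020, Ch. 2] -/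
theorem origin_fibre (hnk : n ≤ k) (w : Spec (.of (chartRing D.c 2))) (hw : blowup.π C (F.q 2 w) = x)
    (h0 : chartGen D.c 2 0 ∈ w.asIdeal) (h1 : chartGen D.c 2 1 ∈ w.asIdeal) :
    Nonempty (SplitShape (stalkIdeal (controlledTransform (blowup.π C) C J n) (F.q 2 w))
      ((originP D.c 2).map (F.χ 2 w)) n (k - n)) := by
  haveI := CentreSeq.isLocallyNoetherian_blowup C
  rw [F.stalkIdeal_controlledTransform C J n hc 2 w]
  exact D.origin hnk w (F.χ 2 w) (F.isLocalization 2 w) (F.comap_eq_maximalIdeal 2 hw)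
    ((F.χ 2 w).comp (chartBase D.c 2)) (fun _ => rfl) h0 h1

/-! ## §P2  Over the generic point `ζ` -/

set_option maxHeartbeats 400000 in -- WRITER NOTE (g16): pre-budgeted (elaboration exceeds 100k = half the tree default; ops-buildfix standing ask)
/-- **UNIQUENESS OVER `ζ`**: a point over `ζ` at which `𝓘₁ ⊆ 𝔪ⁿ` is the origin `ζ₁ = q₂ 𝔴̃₀` of the `W`-chart over
the curve prime (`SplitShape.generic_chart`, `generic_chart_two`). [cite: CossartJannsenSaito2020, Ch. 2] -/
theorem eq_originPt (hn : 2 ≤ n) (hnk : n ≤ k) (x' : ↑(blowup C)) (hx' : blowup.π C x' = ζ)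
    (hle : stalkIdeal (controlledTransform (blowup.π C) C J n) x' ≤ maximalIdeal _ ^ n) :
    x' = F.q 2 (originPt D) := by
  haveI := CentreSeq.isLocallyNoetherian_blowup C
  obtain ⟨j, w, rfl⟩ := F.cover x' ((specializes_of_eq hx').trans hζx)
  have h𝔴 : w.asIdeal.comap (chartBase D.c j) = curvePrime hζx := (F.base_eq_iff j w hζx).mp hx'
  rw [F.stalkIdeal_controlledTransform C J n hc j w] at hle
  obtain ⟨hj, -⟩ := D.generic_chart hn hnk j w (F.χ j w) (F.isLocalization j w) h𝔴
    ((F.χ j w).comp (chartBase D.c j)) (fun _ => rfl) hle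
  subst hj
  have e : w.asIdeal = originP D.c 2 := D.generic_chart_two hn hnk w (F.χ 2 w) (F.isLocalization 2 w) h𝔴
    ((F.χ 2 w).comp (chartBase D.c 2)) (fun _ => rfl) hle
  congr 1
  exact PrimeSpectrum.ext e

/-- **EXIT OVER `ζ`** (`k - n < n`): the order of `𝓘₁` at every point over `ζ` is `< n`. [cite: Hironaka1964] -/
theorem exit_generic (hY' : Scheme.IsRegular ↑(blowup C)) (hkn : k - n < n) (hn : 2 ≤ n) (hnk : n ≤ k)
    (x' : ↑(blowup C)) (hx' : blowup.π C x' = ζ) :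
    ¬ stalkIdeal (controlledTransform (blowup.π C) C J n) x' ≤ maximalIdeal _ ^ n := fun hle => by
  haveI := CentreSeq.isLocallyNoetherian_blowup C
  obtain rfl := eq_originPt D hc F hn hnk x' hx' hle
  obtain ⟨w₀, hw₀, hsp, h0, h1⟩ := F.exists_closedOrigin D
  haveI := hY' (F.q 2 w₀)
  obtain ⟨D'⟩ := origin_fibre D hc F hnk w₀ hw₀ h0 h1
  exact D'.not_le_pow hkn
    (stalkIdeal_le_pow_of_specializes (F.qSpecializes 2 hsp) _ hle)

/-- **EXIT OVER `x`** (`k - n < n`): at every point over `x` of order `n`, Hironaka's `τ ≥ 2`. [cite: Hironaka1964] -/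
theorem exit_closed (hY' : Scheme.IsRegular ↑(blowup C)) (hkn : k - n < n) (hn : 2 ≤ n) (hnk : n ≤ k)
    (x' : ↑(blowup C)) (hx' : blowup.π C x' = x)
    (hle : stalkIdeal (controlledTransform (blowup.π C) C J n) x' ≤ maximalIdeal _ ^ n) :
    2 ≤ tauAt hY' (controlledTransform (blowup.π C) C J n) n x' := by
  haveI := CentreSeq.isLocallyNoetherian_blowup C
  rcases closed_fibre_cases D hc F hY' hn hnk x' hx' hle with hτ | ⟨w, rfl, h0, h1⟩
  · exact hτ
  · obtain ⟨D'⟩ := origin_fibre D hc F hnk w hx' h0 h1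
    exact absurd hle (D'.not_le_pow hkn)

/-! ## §P3  The step case `n ≤ k - n`: the new curve point `ζ₁ = q₂ 𝔴̃₀` -/

omit [IsLocallyNoetherian Y] hc in
/-- `π ζ₁ ⤳ π x₁` whenever `ζ₁ ⤳ x₁`. [folklore] -/
theorem specializes_base_of_originPt_specializes {x' : ↑(blowup C)} (h : F.q 2 (originPt D) ⤳ x') :
    ζ ⤳ blowup.π C x' :=
  (specializes_of_eq (F.base_originPt D).symm).trans ((blowup.π C).base.hom.map_specializes h)

set_option maxHeartbeats 400000 in -- WRITER NOTE (g16): pre-budgeted (elaboration exceeds 100k = half the tree default; ops-buildfix standing ask)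
/-- At a closed origin `𝔴₀` the transform lies in the `n`-th power of the extended origin prime, which is the prime
of the specialisation `q₂ 𝔴̃₀ ⤳ q₂ 𝔴₀`. [cite: CossartJannsenSaito2020, Ch. 2] -/
theorem le_primePow_closedOrigin (hnk : n ≤ k) (hkk : n ≤ k - n) {w₀ : Spec (.of (chartRing D.c 2))}
    (hw₀ : blowup.π C (F.q 2 w₀) = x) (hsp : originPt D ⤳ w₀)
    (h0 : chartGen D.c 2 0 ∈ w₀.asIdeal) (h1 : chartGen D.c 2 1 ∈ w₀.asIdeal) :
    stalkIdeal (controlledTransform (blowup.π C) C J n) (F.q 2 w₀) ≤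
      (primeOfSpecializes (F.qSpecializes 2 hsp)) ^ n := by
  haveI := CentreSeq.isLocallyNoetherian_blowup C
  obtain ⟨D'⟩ := origin_fibre D hc F hnk w₀ hw₀ h0 h1
  rw [F.primeOfSpecializes_q 2 hsp]
  exact D'.le_pow hkk

set_option maxHeartbeats 400000 in -- WRITER NOTE (g16): pre-budgeted (elaboration exceeds 100k = half the tree default; ops-buildfix standing ask)
/-- **`𝓘₁ ⊆ 𝔪ⁿ` AT `ζ₁`** (`n ≤ k - n`): generisation from a closed origin `𝔴₀`. [cite: Hironaka1964] -/
theorem le_pow_originPt (hnk : n ≤ k) (hkk : n ≤ k - n) :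
    stalkIdeal (controlledTransform (blowup.π C) C J n) (F.q 2 (originPt D)) ≤ maximalIdeal _ ^ n := by
  obtain ⟨w₀, hw₀, hsp, h0, h1⟩ := F.exists_closedOrigin D
  exact stalkIdeal_le_pow_of_le_primeOfSpecializes_pow _ _ (le_primePow_closedOrigin D hc F hnk hkk hw₀ hsp h0 h1)

/-- **THE SPECIALISATIONS OF `ζ₁` OVER `ζ`**: only `ζ₁` itself (semicontinuity of the order along `ζ₁ ⤳ x₁` and
uniqueness over `ζ`). [cite: CossartJannsenSaito2020, Ch. 2] -/
theorem eq_of_originPt_specializes (hY' : Scheme.IsRegular ↑(blowup C)) (hn : 2 ≤ n) (hnk : n ≤ k)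
    (hkk : n ≤ k - n) (x' : ↑(blowup C)) (hx' : blowup.π C x' = ζ) (hsp : F.q 2 (originPt D) ⤳ x') :
    x' = F.q 2 (originPt D) := by
  haveI := CentreSeq.isLocallyNoetherian_blowup C
  haveI := hY' x'
  exact eq_originPt D hc F hn hnk x' hx' (stalkIdeal_le_pow_of_specializes hsp _ (le_pow_originPt D hc F hnk hkk))

set_option maxHeartbeats 400000 in -- WRITER NOTE (g16): pre-budgeted (elaboration exceeds 100k = half the tree default; ops-buildfix standing ask)
/-- **THE SPECIALISATIONS OF `ζ₁` OVER `x` ARE ORIGIN-TYPE POINTS** (`n ≤ k - n`): a point `x₁` over `x` with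
`ζ₁ ⤳ x₁` is `q₂ 𝔴` for a prime `𝔴 ∋ e₀, e₁` to which `𝔴̃₀` specialises (lift the specialisation into a chart and
apply `SplitShape.generic_chart` at the lifted point). [cite: CossartJannsenSaito2020, Ch. 2] -/
theorem exists_origin_of_originPt_specializes (hn : 2 ≤ n) (hnk : n ≤ k) (hkk : n ≤ k - n) (x' : ↑(blowup C))
    (hx' : blowup.π C x' = x) (h : F.q 2 (originPt D) ⤳ x') :
    ∃ w : Spec (.of (chartRing D.c 2)), F.q 2 w = x' ∧ originPt D ⤳ w ∧
      chartGen D.c 2 0 ∈ w.asIdeal ∧ chartGen D.c 2 1 ∈ w.asIdeal := by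
  haveI := CentreSeq.isLocallyNoetherian_blowup C
  obtain ⟨j, w, rfl⟩ := F.cover x' (specializes_of_eq hx')
  obtain ⟨p₁, hp₁w, hp₁⟩ := F.lift j 2 (originPt D) w h
  have hP₁ : p₁.asIdeal.comap (chartBase D.c j) = curvePrime hζx :=
    (F.base_eq_iff j p₁ hζx).mp (by rw [hp₁]; exact F.base_originPt D)
  have hle₁ : stalkIdeal (controlledTransform (blowup.π C) C J n) (F.q j p₁) ≤ maximalIdeal _ ^ n := by
    rw [hp₁]; exact le_pow_originPt D hc F hnk hkk
  rw [F.stalkIdeal_controlledTransform C J n hc j p₁] at hle₁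
  obtain ⟨hj, hgen⟩ := D.generic_chart hn hnk j p₁ (F.χ j p₁) (F.isLocalization j p₁) hP₁
    ((F.χ j p₁).comp (chartBase D.c j)) (fun _ => rfl) hle₁
  subst hj
  have hpw : p₁.asIdeal ≤ w.asIdeal := (PrimeSpectrum.le_iff_specializes p₁ w).mpr hp₁w
  have hp₁eq : p₁ = originPt D :=
    PrimeSpectrum.ext (eq_originP D.c 2 D.rsop.isQuasiRegular D.span_c hP₁ hgen)
  subst hp₁eq
  exact ⟨w, rfl, hp₁w, hpw (hgen 0 (by decide)), hpw (hgen 1 (by decide))⟩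

set_option maxHeartbeats 400000 in -- WRITER NOTE (g16): pre-budgeted (elaboration exceeds 100k = half the tree default; ops-buildfix standing ask)
/-- **THE SPECIALISATIONS OF `ζ₁` OVER `x` CARRY THE NEW SHAPE** (`n ≤ k - n`): at a point `x₁` over `x` with
`ζ₁ ⤳ x₁`, `𝓘₁` has a split shape of weight `k - n` along the curve prime `𝔓_{ζ₁, x₁} = 𝔓̃ S` (`SplitShape.origin`
and the chart presentation of `𝔓_{ζ₁,x₁}`).  Stated for any `z = ζ₁`. [cite: CossartJannsenSaito2020, Ch. 2] -/
theorem shape_of_originPt_specializes (hn : 2 ≤ n) (hnk : n ≤ k) (hkk : n ≤ k - n) (z : ↑(blowup C))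
    (hz : z = F.q 2 (originPt D)) (x' : ↑(blowup C)) (hx' : blowup.π C x' = x) (h : z ⤳ x') :
    Nonempty (SplitShape (stalkIdeal (controlledTransform (blowup.π C) C J n) x') (curvePrime h) n (k - n)) := by
  subst hz
  obtain ⟨w, rfl, hsp, h0, h1⟩ := exists_origin_of_originPt_specializes D hc F hn hnk hkk x' hx' h
  obtain ⟨D'⟩ := origin_fibre D hc F hnk w hx' h0 h1
  have hPeq : (originP D.c 2).map (F.χ 2 w) = curvePrime h := by
    rw [← originPt_asIdeal, ← F.primeOfSpecializes_q 2 hsp]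
    rfl
  exact ⟨hPeq ▸ D'⟩

/-- **`τ ≥ 2` OFF THE NEW CURVE** over `x`: at a point `x₁` over `x` of order `n` to which `ζ₁` does NOT specialise,
Hironaka's `τ ≥ 2` (the origin-type points are specialisations of `ζ₁`). [cite: Hironaka1964] -/
theorem tau_of_not_specializes (hY' : Scheme.IsRegular ↑(blowup C)) (hn : 2 ≤ n) (hnk : n ≤ k)
    (x' : ↑(blowup C)) (hx' : blowup.π C x' = x)
    (hle : stalkIdeal (controlledTransform (blowup.π C) C J n) x' ≤ maximalIdeal _ ^ n)
    (hns : ¬ F.q 2 (originPt D) ⤳ x') : 2 ≤ tauAt hY' (controlledTransform (blowup.π C) C J n) n x' := by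
  rcases closed_fibre_cases D hc F hY' hn hnk x' hx' hle with hτ | ⟨w, rfl, h0, h1⟩
  · exact hτ
  · refine absurd (F.qSpecializes 2 (originPt_specializes D ?_ h0 h1)) hns
    rw [F.comap_eq_maximalIdeal 2 hx']
    exact D.le_maximalIdeal

omit [IsLocallyNoetherian Y] hc in
/-- **A PROPER SPECIALISATION OF `ζ₁`** (`x ≠ ζ`): the chart point over a closed origin. [folklore] -/
theorem exists_special_originPt (hxζ : x ≠ ζ) :
    ∃ x₁ : ↑(blowup C), F.q 2 (originPt D) ⤳ x₁ ∧ x₁ ≠ F.q 2 (originPt D) := by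
  obtain ⟨w₀, hw₀, hsp, -, -⟩ := F.exists_closedOrigin D
  refine ⟨F.q 2 w₀, F.qSpecializes 2 hsp, fun e => hxζ ?_⟩
  rw [← hw₀, e]
  exact F.base_originPt D

end Point

end Summit.ResolutionOfSingularities.ResolutionOfSingularities.Theorems.SplitTower

end
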